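import Mathlib
import HarnessLib
import Summits.NavierStokesRegularity.NavierStokesRegularity.Theorems.TaylorModelRungThreeCertificateBoxFieldD
import Summits.NavierStokesRegularity.NavierStokesRegularity.Theorems.TaylorModelRungThreeCertificateIntervalDJetsArrayR2

/-!
# Crux K1b-DR (stmt-NavierStokesRegularity-23954), line `taylor-model` — interval VARIATIONAL jets, jet DIFFERENCES and second-order
# REMAINDERS of the truncated cascade flow over boxes (the (V1) `JV`, (D1) `JD`, `R2` suppliers of VECTOR-LEMMAS-23954 §2 / CERT-CONTRACT-v3 §3 C2)

`…CertificateBoxFieldD` packaged the interval twin `QbBoxA` of the symmetrised truncated field and the interval Taylor jets of the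
cascade flow over an a-priori box (`mem_taylorJet_of_jetLevelsA`). This file adds the two companions the v3 sub-step clauses test:
* `mem_varJet_of_varJetLevelsA` — for a shell state `y` with window coordinates in `Y` and a direction `v` with window coordinates in
  `D`, every variational jet `varJet d.Qb y v k` (`k ≤ K`, engine-1's `…ReadoutJets`) has its window coordinates in
  `varJetLevelsA T.n (T.QbBoxA coefB prec) prec (jetLevelsA T.n (T.QbBoxA coefB prec) prec Y K) D K`;
* `mem_taylorJet_sub_of_diffJetLevelsA` — for `y` with coordinates in `Y` and a second state `y'` with `T.wv y' − T.wv y` in `D`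
  (coordinatewise), every jet DIFFERENCE `taylorJet d.Qb y' k − taylorJet d.Qb y k` has its window coordinates in
  `diffJetLevelsA T.n (T.QbBoxA coefB prec) prec (jetLevelsA …) D K` (uses `Qb_add_left/right`);
* `mem_taylorJet_r2_of_r2LevelsA` — the second-order remainders `taylorJet d.Qb y' k − taylorJet d.Qb y k − varJet d.Qb y (y'−y) k`
  (the `R2_k(D₀)` of the Lohner form) have their window coordinates in `r2LevelsA T.n (T.QbBoxA coefB prec) prec (jetLevelsA …)
  (diffJetLevelsA …) K`.

MODEL-lattice bookkeeping only (rung TL-M3); nothing here concerns the Navier–Stokes equations.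
-/

-- the sub-problem namespace repeats the summit name by design (D-0017)
set_option linter.dupNamespace false

namespace Summit.NavierStokesRegularity.NavierStokesRegularity.Theorems.TaylorModelCert

open scoped BigOperators
open Literature.Analysis.FluidPDE.TaoCascade Literature.Analysis.FluidPDE.TaoCascade.TaylorChain
open Summit.NavierStokesRegularity.NavierStokesRegularity.Theorems.TaylorModelReadout (Qb_add_left Qb_add_right taylorJet
  taylorJet_zero taylorJet_succ varJet varJet_zero varJet_succ)

namespace CertTables

section Sound

variable {K : Type} [Field K] {φ : K →+* ℝ} (T : CertTables K) {coefB : Fin 4 → Fin 4 → Fin 4 → ℕ → ℤ → IntervalD}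

omit [Field K] in
/-- The window reader is additive. [folklore] -/
theorem wv_add (u w : Fin 4 → ℤ → ℝ) (c : ℕ) : T.wv (u + w) c = T.wv u c + T.wv w c := rfl

/-- The Taylor-jet recursion of `d.Qb`, read through the window coordinates. [folklore] -/
theorem wv_taylorJet_succ (x : Fin 4 → ℤ → ℝ) (k : ℕ) (c : ℕ) :
    ((k : ℝ) + 1) * T.wv (taylorJet (T.toCertData φ).Qb x (k + 1)) c =
      ∑ i ∈ Finset.range (k + 1), T.wv ((T.toCertData φ).Qb (taylorJet (T.toCertData φ).Qb x i)
        (taylorJet (T.toCertData φ).Qb x (k - i))) c := by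
  have h := congrFun (congrFun (taylorJet_succ (T.toCertData φ).Qb x k) (T.wi c)) (T.wk c)
  simp only [Pi.smul_apply, smul_eq_mul, Finset.sum_apply] at h
  simpa only [wv] using h

/-- The variational-jet recursion of `d.Qb`, read through the window coordinates. [folklore] -/
theorem wv_varJet_succ (x v : Fin 4 → ℤ → ℝ) (k : ℕ) (c : ℕ) :
    ((k : ℝ) + 1) * T.wv (varJet (T.toCertData φ).Qb x v (k + 1)) c =
      ∑ i ∈ Finset.range (k + 1), (T.wv ((T.toCertData φ).Qb (taylorJet (T.toCertData φ).Qb x i)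
        (varJet (T.toCertData φ).Qb x v (k - i))) c +
        T.wv ((T.toCertData φ).Qb (varJet (T.toCertData φ).Qb x v (k - i)) (taylorJet (T.toCertData φ).Qb x i)) c) := by
  have h := congrFun (congrFun (varJet_succ (T.toCertData φ).Qb x v k) (T.wi c)) (T.wk c)
  simp only [Pi.smul_apply, smul_eq_mul, Finset.sum_apply, Pi.add_apply] at h
  simpa only [wv] using h

/-- **Interval variational jets of the truncated cascade flow**: window coordinates of `varJet d.Qb y v k` lie in the materialised
variational levels along the state levels of `y`, for `y` in the box `Y` and the direction `v` in the box `D`. [folklore] -/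
theorem mem_varJet_of_varJetLevelsA (hco : T.CoefOK φ) (hcB : CoefBoxOK φ T coefB) (prec K : ℕ) {Y D : Array IntervalD}
    (hY : Y.size = T.n) (hD : D.size = T.n) {y v : Fin 4 → ℤ → ℝ} (hy : ∀ c < T.n, IntervalD.mem (T.wv y c) (IntervalD.aget Y c))
    (hv : ∀ c < T.n, IntervalD.mem (T.wv v c) (IntervalD.aget D c)) :
    ∀ k ≤ K, ∀ c < T.n, IntervalD.mem (T.wv (varJet (T.toCertData φ).Qb y v k) c)
      (IntervalD.aget (IntervalD.lget (IntervalD.varJetLevelsA T.n (T.QbBoxA coefB prec) prec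
        (IntervalD.jetLevelsA T.n (T.QbBoxA coefB prec) prec Y K) D K) k) c) :=
  IntervalD.mem_varJet_of_varJetLevelsA (T := taylorJet (T.toCertData φ).Qb) (U := varJet (T.toCertData φ).Qb)
    (fun x c _ => by rw [taylorJet_zero]) (fun x k c _ => T.wv_taylorJet_succ x k c) (fun x v c _ => by rw [varJet_zero])
    (fun x v k c _ => T.wv_varJet_succ x v k c) (T.isFieldEnclosureA_QbBoxA hco hcB prec) prec K hY hD hy hv

/-- **Interval jet differences of the truncated cascade flow**: window coordinates of `taylorJet d.Qb y' k − taylorJet d.Qb y k`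
lie in the materialised difference levels along the state levels of `y`, for `y` in the box `Y` and the coordinate displacement
`T.wv y' − T.wv y` in the box `D` (no box hypothesis on `y'`). [folklore] -/
theorem mem_taylorJet_sub_of_diffJetLevelsA (hco : T.CoefOK φ) (hcB : CoefBoxOK φ T coefB) (prec K : ℕ)
    {Y D : Array IntervalD} (hY : Y.size = T.n) (hD : D.size = T.n) {y y' : Fin 4 → ℤ → ℝ}
    (hy : ∀ c < T.n, IntervalD.mem (T.wv y c) (IntervalD.aget Y c))
    (hd : ∀ c < T.n, IntervalD.mem (T.wv y' c - T.wv y c) (IntervalD.aget D c)) :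
    ∀ k ≤ K, ∀ c < T.n, IntervalD.mem (T.wv (taylorJet (T.toCertData φ).Qb y' k) c - T.wv (taylorJet (T.toCertData φ).Qb y k) c)
      (IntervalD.aget (IntervalD.lget (IntervalD.diffJetLevelsA T.n (T.QbBoxA coefB prec) prec
        (IntervalD.jetLevelsA T.n (T.QbBoxA coefB prec) prec Y K) D K) k) c) :=
  IntervalD.mem_diffJet_of_diffJetLevelsA (T := taylorJet (T.toCertData φ).Qb) (Qb_add_left (T.toCertData φ))
    (Qb_add_right (T.toCertData φ)) (fun x z c _ => T.wv_add x z c) (fun x c _ => by rw [taylorJet_zero])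
    (fun x k c _ => T.wv_taylorJet_succ x k c) (T.isFieldEnclosureA_QbBoxA hco hcB prec) prec K hY hD hy hd

/-- **Interval second-order remainders of the truncated cascade flow** (the `R2_k(D₀)` table of the Lohner form): window coordinates
of `taylorJet d.Qb y' k − taylorJet d.Qb y k − varJet d.Qb y (y' − y) k` lie in the materialised remainder levels, for `y` in the box `Y`
and the coordinate displacement `T.wv y' − T.wv y` in the box `D`. [folklore] -/
theorem mem_taylorJet_r2_of_r2LevelsA (hco : T.CoefOK φ) (hcB : CoefBoxOK φ T coefB) (prec K : ℕ)
    {Y D : Array IntervalD} (hY : Y.size = T.n) (hD : D.size = T.n) {y y' : Fin 4 → ℤ → ℝ}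
    (hy : ∀ c < T.n, IntervalD.mem (T.wv y c) (IntervalD.aget Y c))
    (hd : ∀ c < T.n, IntervalD.mem (T.wv y' c - T.wv y c) (IntervalD.aget D c)) :
    ∀ k ≤ K, ∀ c < T.n, IntervalD.mem (T.wv (taylorJet (T.toCertData φ).Qb y' k) c - T.wv (taylorJet (T.toCertData φ).Qb y k) c -
        T.wv (varJet (T.toCertData φ).Qb y (y' - y) k) c)
      (IntervalD.aget (IntervalD.lget (IntervalD.r2LevelsA T.n (T.QbBoxA coefB prec) prec
        (IntervalD.jetLevelsA T.n (T.QbBoxA coefB prec) prec Y K)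
        (IntervalD.diffJetLevelsA T.n (T.QbBoxA coefB prec) prec (IntervalD.jetLevelsA T.n (T.QbBoxA coefB prec) prec Y K) D K) K)
        k) c) :=
  IntervalD.mem_r2_of_r2LevelsA (T := taylorJet (T.toCertData φ).Qb) (U := varJet (T.toCertData φ).Qb)
    (Qb_add_left (T.toCertData φ)) (Qb_add_right (T.toCertData φ)) (fun x z c _ => T.wv_add x z c)
    (fun x c _ => by rw [taylorJet_zero]) (fun x k c _ => T.wv_taylorJet_succ x k c) (fun x v c _ => by rw [varJet_zero])
    (fun x v k c _ => T.wv_varJet_succ x v k c) (T.isFieldEnclosureA_QbBoxA hco hcB prec) prec K hY hD hy hd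

end Sound

end CertTables

end Summit.NavierStokesRegularity.NavierStokesRegularity.Theorems.TaylorModelCert
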